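import Mathlib
import HarnessLib
import Summits.AtomisticToContinuum.HydrodynamicLimit.Theses.CollisionIsometryCLT

/-!
# Sketch — crux-ideate stmt-AtomisticToContinuum-9518 (`CollisionalTransferLocality`), ideator 1, round 1

First-lemma signatures for the idea cards (elaboration only; nothing here is proved or filed as an item).

* Card `conditional-covariance-liouville-rigidity`:
  `CovarianceRigidityCore` (the finite-dimensional core of OVY's step (D) with step (B) weakened to a
  conditional-covariance identity: stationarity under free streaming tested against velocity-linear
  observables + conditional covariance `θ δᵢⱼ 𝟙` ⇒ the positional law has zero distributional gradient
  off the contact set) and `ConditionalKineticCovariance` (the finite-`N` transfer statement C⁺: block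
  kinetic covariance stays `θ̄ δᵢⱼ 𝟙` when particles/pairs are re-weighted by ANY bounded microscopic
  configurational weight, contact shell included).
* Card `window-tree-far-field-comparison`: `FarFieldPairChaos` (the `k = 2` instance of the transfer
  statement C⁺: pair statistics at microscopic separations in a far shell `d₀ ≤ |r| ≤ L` factorise
  into block-local Maxwellians, in probability, time-integrated).
* Card `loschmidt-selection-collisional-channel`: `SelectionLemma` (isentropy against all smooth
  data makes `ρ(Z-1) - π_c` constant) and `DilutePin` (quadratic diluteness pins the constant to `0`).
-/

namespace Summit.AtomisticToContinuum.HydrodynamicLimit.Cruxes.CollisionalTransferLocality.Sketch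

open scoped BigOperators Topology Classical MeasureTheory InnerProductSpace
open Filter Set Function MeasureTheory

/-- **Card 1, first lemma (covariance rigidity core).** On `n`-particle Euclidean phase space, let
`μ` be a finite measure with finite second velocity moments such that (i) tested against every smooth
compactly supported `φ` with `tsupport φ ⊆ Ω` (Ω open: "off the contact set") the conditional velocity
covariance is `θ δᵢⱼ δ_ab` (`hcov`), and (ii) `μ` is stationary under free streaming when tested against
the velocity-linear observables `φ(q) · v_j^b` (`hstat`: `∫ (Dφ(q)·v) v_j^b dμ = 0`, the interior part
of flow-invariance for hard spheres, where the Liouville operator is pure free streaming off contacts).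
Then the positional marginal has zero distributional gradient on `Ω`: `∫ ∂_{j,b} φ dμ = 0` — i.e. it is
a constant multiple of Lebesgue measure on each connected component of `Ω` (the hard-sphere Gibbs
configurational law). Proof: put `ℓ(v) = v_j^b` in `hstat`, expand `Dφ(q)·v = Σ_{i,a} ∂_{i,a}φ · v_i^a`,
apply `hcov` to each `∂_{i,a}φ` (again an admissible test function) and divide by `θ > 0`. -/
def CovarianceRigidityCore : Prop :=
  ∀ (n : ℕ) (θ : ℝ), 0 < θ →
    ∀ (Ω : Set (Fin n → EuclideanSpace ℝ (Fin 3))), IsOpen Ω →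
    ∀ (μ : Measure ((Fin n → EuclideanSpace ℝ (Fin 3)) × (Fin n → EuclideanSpace ℝ (Fin 3)))),
      IsFiniteMeasure μ →
      Integrable (fun z => ‖z.2‖ ^ 2) μ →
      (∀ φ : (Fin n → EuclideanSpace ℝ (Fin 3)) → ℝ, ContDiff ℝ (⊤ : ℕ∞) φ → HasCompactSupport φ →
          tsupport φ ⊆ Ω → ∀ (i j : Fin n) (a b : Fin 3),
            ∫ z, φ z.1 * (z.2 i a * z.2 j b) ∂μ
              = (if i = j ∧ a = b then θ else 0) * ∫ z, φ z.1 ∂μ) →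
      (∀ φ : (Fin n → EuclideanSpace ℝ (Fin 3)) → ℝ, ContDiff ℝ (⊤ : ℕ∞) φ → HasCompactSupport φ →
          tsupport φ ⊆ Ω → ∀ (j : Fin n) (b : Fin 3),
            ∫ z, (fderiv ℝ φ z.1 z.2) * z.2 j b ∂μ = 0) →
      ∀ φ : (Fin n → EuclideanSpace ℝ (Fin 3)) → ℝ, ContDiff ℝ (⊤ : ℕ∞) φ → HasCompactSupport φ →
        tsupport φ ⊆ Ω → ∀ (j : Fin n) (b : Fin 3),
          ∫ z, fderiv ℝ φ z.1 (Pi.single j (EuclideanSpace.single b (1 : ℝ))) ∂μ = 0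

/-- **Card 1, transfer statement C⁺ (finite `N`, orders 1–2; order 3 analogous).** Under the local
Gibbs law and the deterministic flow, for every bounded continuous MICROSCOPIC pair weight `Ψ` of the
minimal-image separation blown up by `(N+1)^{1/3}` (any support — the contact shell
`σ ≤ |r| ≤ σ(1+ϵ)` included) and every continuous macroscopic localisation `χ`, the time-integrated
cross-covariance of the block-centred velocities of `Ψ`-related pairs and the `Ψ`-neighbour-count
weighted self-covariance defect both vanish in probability: velocities are conditionally uncorrelated
and isotropic at the block temperature GIVEN the microscopic configuration around the particle. -/
def ConditionalKineticCovariance : Prop :=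
  ∀ (a₀ θ₀ : (UnitAddTorus (Fin 3)) → ℝ) (u₀ : (UnitAddTorus (Fin 3)) → (EuclideanSpace ℝ (Fin 3))),
    Continuous a₀ → Continuous θ₀ → Continuous u₀ → (∀ x, 0 < a₀ x) → (∀ x, 0 < θ₀ x) →
    ∃ σ₀ : ℝ, 0 < σ₀ ∧ ∀ σ : ℝ, 0 < σ → σ < σ₀ →
    ∀ Φ : (N : ℕ) → Literature.Analysis.FluidPDE.HardSphereFlow
        (Literature.Analysis.FluidPDE.Torus.geometry (Fin 3))
        (Literature.MathematicalPhysics.KineticTheory.hsDiameter σ N) (N + 1),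
    ∀ (γ C : ℝ) (φ : ℕ → (UnitAddTorus (Fin 3)) → ℝ), 0 < γ → γ ≤ 1 / 15 →
      ((∀ N, Literature.Analysis.FunctionSpaces.Torus.IsSmooth (φ N)) ∧ (∀ N y, 0 ≤ φ N y) ∧
        (∀ N, ∫ y, φ N y = 1) ∧
        (∀ (N : ℕ) y, ((N : ℝ) + 1) ^ (-γ) ≤ Literature.Analysis.FluidPDE.Torus.euclidDist y 0 →
          φ N y = 0) ∧
        (∀ (N : ℕ) y, φ N y ≤ C * ((N : ℝ) + 1) ^ (3 * γ)) ∧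
        (∀ (N : ℕ) y, ‖Literature.Analysis.FunctionSpaces.Torus.gradient (φ N) y‖
          ≤ C * ((N : ℝ) + 1) ^ (4 * γ))) →
    let ρb := fun (N : ℕ) (z : Literature.Analysis.FluidPDE.Config (N + 1) (Fin 3) (UnitAddTorus (Fin 3)))
        (x : UnitAddTorus (Fin 3)) =>
      Literature.MathematicalPhysics.KineticTheory.empiricalDensityField z (fun y => φ N (y - x))
    let mb := fun (N : ℕ) (z : Literature.Analysis.FluidPDE.Config (N + 1) (Fin 3) (UnitAddTorus (Fin 3)))
        (x : UnitAddTorus (Fin 3)) =>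
      Literature.MathematicalPhysics.KineticTheory.empiricalMomentumField z (fun y => φ N (y - x))
    let Eb := fun (N : ℕ) (z : Literature.Analysis.FluidPDE.Config (N + 1) (Fin 3) (UnitAddTorus (Fin 3)))
        (x : UnitAddTorus (Fin 3)) =>
      Literature.MathematicalPhysics.KineticTheory.empiricalEnergyField z (fun y => φ N (y - x))
    let ub := fun (N : ℕ) (z : Literature.Analysis.FluidPDE.Config (N + 1) (Fin 3) (UnitAddTorus (Fin 3)))
        (x : UnitAddTorus (Fin 3)) => (ρb N z x)⁻¹ • mb N z x
    let θb := fun (N : ℕ) (z : Literature.Analysis.FluidPDE.Config (N + 1) (Fin 3) (UnitAddTorus (Fin 3)))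
        (x : UnitAddTorus (Fin 3)) =>
      2 / 3 * (Eb N z x / ρb N z x - ‖mb N z x‖ ^ 2 / (2 * ρb N z x ^ 2))
    ∀ (Ψ : EuclideanSpace ℝ (Fin 3) → ℝ) (χ : UnitAddTorus (Fin 3) → ℝ),
      Continuous Ψ → HasCompactSupport Ψ → (∀ r, |Ψ r| ≤ 1) → Continuous χ → (∀ x, |χ x| ≤ 1) →
    -- microscopic pair weight between particles i and j of the configuration z
    let w := fun (N : ℕ) (z : Literature.Analysis.FluidPDE.Config (N + 1) (Fin 3) (UnitAddTorus (Fin 3)))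
        (i j : Fin (N + 1)) =>
      Ψ ((((N : ℝ) + 1) ^ ((1 : ℝ) / 3)) •
        Literature.Analysis.FluidPDE.Torus.reprSym ((z i).1 - (z j).1))
    -- cross-covariance statistic (orders 1–2, i ≠ j)
    let T := fun (N : ℕ) (z : Literature.Analysis.FluidPDE.Config (N + 1) (Fin 3) (UnitAddTorus (Fin 3)))
        (a b : Fin 3) =>
      (((N : ℝ) + 1))⁻¹ * ∑ i : Fin (N + 1), ∑ j : Fin (N + 1),
        (if i = j then 0 else
          χ (z i).1 * w N z i j *
            (((z i).2 a - ub N z (z i).1 a) * ((z j).2 b - ub N z (z i).1 b)))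
    -- neighbour-count weighted self-covariance defect
    let U := fun (N : ℕ) (z : Literature.Analysis.FluidPDE.Config (N + 1) (Fin 3) (UnitAddTorus (Fin 3)))
        (a b : Fin 3) =>
      (((N : ℝ) + 1))⁻¹ * ∑ i : Fin (N + 1),
        (∑ j : Fin (N + 1), (if i = j then 0 else w N z i j)) * χ (z i).1 *
          (((z i).2 a - ub N z (z i).1 a) * ((z i).2 b - ub N z (z i).1 b)
            - (if a = b then θb N z (z i).1 else 0))
    ∀ t : ℝ, 0 < t → ∀ (a b : Fin 3) (δ : ℝ), 0 < δ →
      Tendsto (fun N : ℕ => Literature.MathematicalPhysics.KineticTheory.localGibbsLaw σ a₀ u₀ θ₀ N (Φ N)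
        {z | δ < |∫ s in Icc 0 t, T N ((Φ N).flow s z) a b| + |∫ s in Icc 0 t, U N ((Φ N).flow s z) a b|})
        atTop (𝓝 0)

/-- **Card 2, transfer statement C⁺ at order `k = 2` (far-field pair chaos).** For every accuracy
`δ` there is a microscopic far-field radius `d₀` (in units of `(N+1)^{-1/3}`, independent of `N`)
such that for every bounded continuous pair weight `Ψ` supported in the shell `d₀ ≤ |r|` (and of
compact support), every bounded continuous velocity test `F` and macroscopic localisation `χ`, the
time-integrated empirical pair statistic equals, up to `δ` with probability `→ 1`, the same statistic
of the PRODUCT of block-local Maxwellians (`ρ̄(x) M_{1,ū(x),θ̄(x)}`) — molecular chaos at the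
mean-free-path scale (positions AND velocities), with the block fields read off the configuration. -/
def FarFieldPairChaos : Prop :=
  ∀ (a₀ θ₀ : (UnitAddTorus (Fin 3)) → ℝ) (u₀ : (UnitAddTorus (Fin 3)) → (EuclideanSpace ℝ (Fin 3))),
    Continuous a₀ → Continuous θ₀ → Continuous u₀ → (∀ x, 0 < a₀ x) → (∀ x, 0 < θ₀ x) →
    ∃ σ₀ : ℝ, 0 < σ₀ ∧ ∀ σ : ℝ, 0 < σ → σ < σ₀ →
    ∀ Φ : (N : ℕ) → Literature.Analysis.FluidPDE.HardSphereFlow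
        (Literature.Analysis.FluidPDE.Torus.geometry (Fin 3))
        (Literature.MathematicalPhysics.KineticTheory.hsDiameter σ N) (N + 1),
    ∀ (γ C : ℝ) (φ : ℕ → (UnitAddTorus (Fin 3)) → ℝ), 0 < γ → γ ≤ 1 / 15 →
      ((∀ N, Literature.Analysis.FunctionSpaces.Torus.IsSmooth (φ N)) ∧ (∀ N y, 0 ≤ φ N y) ∧
        (∀ N, ∫ y, φ N y = 1) ∧
        (∀ (N : ℕ) y, ((N : ℝ) + 1) ^ (-γ) ≤ Literature.Analysis.FluidPDE.Torus.euclidDist y 0 →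
          φ N y = 0) ∧
        (∀ (N : ℕ) y, φ N y ≤ C * ((N : ℝ) + 1) ^ (3 * γ)) ∧
        (∀ (N : ℕ) y, ‖Literature.Analysis.FunctionSpaces.Torus.gradient (φ N) y‖
          ≤ C * ((N : ℝ) + 1) ^ (4 * γ))) →
    let ρb := fun (N : ℕ) (z : Literature.Analysis.FluidPDE.Config (N + 1) (Fin 3) (UnitAddTorus (Fin 3)))
        (x : UnitAddTorus (Fin 3)) =>
      Literature.MathematicalPhysics.KineticTheory.empiricalDensityField z (fun y => φ N (y - x))
    let mb := fun (N : ℕ) (z : Literature.Analysis.FluidPDE.Config (N + 1) (Fin 3) (UnitAddTorus (Fin 3)))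
        (x : UnitAddTorus (Fin 3)) =>
      Literature.MathematicalPhysics.KineticTheory.empiricalMomentumField z (fun y => φ N (y - x))
    let Eb := fun (N : ℕ) (z : Literature.Analysis.FluidPDE.Config (N + 1) (Fin 3) (UnitAddTorus (Fin 3)))
        (x : UnitAddTorus (Fin 3)) =>
      Literature.MathematicalPhysics.KineticTheory.empiricalEnergyField z (fun y => φ N (y - x))
    let ub := fun (N : ℕ) (z : Literature.Analysis.FluidPDE.Config (N + 1) (Fin 3) (UnitAddTorus (Fin 3)))
        (x : UnitAddTorus (Fin 3)) => (ρb N z x)⁻¹ • mb N z x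
    let θb := fun (N : ℕ) (z : Literature.Analysis.FluidPDE.Config (N + 1) (Fin 3) (UnitAddTorus (Fin 3)))
        (x : UnitAddTorus (Fin 3)) =>
      2 / 3 * (Eb N z x / ρb N z x - ‖mb N z x‖ ^ 2 / (2 * ρb N z x ^ 2))
    ∀ δ : ℝ, 0 < δ → ∃ d₀ : ℝ, 0 < d₀ ∧
    ∀ (Ψ : EuclideanSpace ℝ (Fin 3) → ℝ) (F : EuclideanSpace ℝ (Fin 3) → EuclideanSpace ℝ (Fin 3) → ℝ)
      (χ : UnitAddTorus (Fin 3) → ℝ),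
      Continuous Ψ → HasCompactSupport Ψ → (∀ r, |Ψ r| ≤ 1) → (∀ r, ‖r‖ < d₀ → Ψ r = 0) →
      Continuous (Function.uncurry F) → (∀ v w, |F v w| ≤ 1) → Continuous χ → (∀ x, |χ x| ≤ 1) →
    -- empirical far-field pair statistic
    let S := fun (N : ℕ) (z : Literature.Analysis.FluidPDE.Config (N + 1) (Fin 3) (UnitAddTorus (Fin 3))) =>
      (((N : ℝ) + 1))⁻¹ * ∑ i : Fin (N + 1), ∑ j : Fin (N + 1),
        (if i = j then 0 else
          χ (z i).1 *
            Ψ ((((N : ℝ) + 1) ^ ((1 : ℝ) / 3)) •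
              Literature.Analysis.FluidPDE.Torus.reprSym ((z i).1 - (z j).1)) *
            F (z i).2 (z j).2)
    -- the same statistic for the product of block-local Maxwellians
    let Sprod := fun (N : ℕ) (z : Literature.Analysis.FluidPDE.Config (N + 1) (Fin 3) (UnitAddTorus (Fin 3))) =>
      (((N : ℝ) + 1)) * ∫ x : UnitAddTorus (Fin 3), ∫ y : UnitAddTorus (Fin 3),
        χ x * Ψ ((((N : ℝ) + 1) ^ ((1 : ℝ) / 3)) • Literature.Analysis.FluidPDE.Torus.reprSym (x - y)) *
          (ρb N z x * ρb N z y) *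
          ∫ v : EuclideanSpace ℝ (Fin 3), ∫ w : EuclideanSpace ℝ (Fin 3),
            F v w * Literature.Analysis.FluidPDE.localMaxwellian 1 (θb N z x) (ub N z x) v *
              Literature.Analysis.FluidPDE.localMaxwellian 1 (θb N z y) (ub N z y) w
    ∀ t : ℝ, 0 < t →
      Tendsto (fun N : ℕ => Literature.MathematicalPhysics.KineticTheory.localGibbsLaw σ a₀ u₀ θ₀ N (Φ N)
        {z | δ < |∫ s in Icc 0 t, (S N ((Φ N).flow s z) - Sprod N ((Φ N).flow s z))|})
        atTop (𝓝 0)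

/-- **Card 3, first lemma (selection calculus on `𝕋³`, provable now).** If a function `g`,
continuous on an open density interval `(a, b)`, does no net work against the divergence of ANY
smooth velocity field for ANY smooth density profile with values in `(a, b)` —
`∫ g(ρ(x)) · div u(x) dx = 0` — then `g` is constant on `(a, b)`. Applied to
`g(ρ) = ρ (Z(ρσ³) - 1) - π_c(ρ)` (equilibrium minus EOS-agnostic collisional pressure, per unit
temperature) this is the selection step: isentropy for all smooth data leaves a one-parameter family
`π_c = ρ(Z - 1) - c`, and quadratic diluteness of the collisional transfer (`π_c(ρ) = O(ρ²)`,
`ρ(Z - 1) = O(ρ²)`) pins `c = 0`. (Proof sketch: integrate by parts, `∫ g(ρ) div u = -∫ g'(ρ) ∇ρ · u`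
in the smooth case; in general mollify `g`, or choose `u = ∇ρ · ζ` and profiles `ρ` sweeping `(a,b)`.) -/
def SelectionLemma : Prop :=
  ∀ (g : ℝ → ℝ) (a b : ℝ), a < b → ContinuousOn g (Set.Ioo a b) →
    (∀ (ρ : UnitAddTorus (Fin 3) → ℝ) (u : UnitAddTorus (Fin 3) → EuclideanSpace ℝ (Fin 3)),
        Literature.Analysis.FunctionSpaces.Torus.IsSmooth ρ →
        Literature.Analysis.FunctionSpaces.Torus.IsSmooth u →
        (∀ x, ρ x ∈ Set.Ioo a b) →
        ∫ x, g (ρ x) * Literature.Analysis.FunctionSpaces.Torus.divergence u x = 0) →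
    ∀ r₁ ∈ Set.Ioo a b, ∀ r₂ ∈ Set.Ioo a b, g r₁ = g r₂

/-- **Card 3, the pin.** With `g σ π := fun ρ => ρ * (hsCompressibility (ρ σ³) - 1) - π ρ`: if `g`
is constant on `(0, b)` and both `ρ (Z(ρσ³) - 1)` and `π_c` are `O(ρ²)` at `0⁺`, the constant is `0`,
i.e. `π_c ρ = ρ (Z(ρσ³) - 1)` on `(0, b)` — the collisional pressure per unit temperature IS the
hard-sphere excess compressibility. Elementary real analysis. -/
def DilutePin : Prop :=
  ∀ (σ b C : ℝ) (π_c : ℝ → ℝ), 0 < b →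
    (∀ ρ ∈ Set.Ioo 0 b, |π_c ρ| ≤ C * ρ ^ 2) →
    (∀ ρ ∈ Set.Ioo 0 b,
      |ρ * (Literature.MathematicalPhysics.KineticTheory.hsCompressibility (ρ * σ ^ 3) - 1)| ≤ C * ρ ^ 2) →
    (∃ c : ℝ, ∀ ρ ∈ Set.Ioo 0 b,
      ρ * (Literature.MathematicalPhysics.KineticTheory.hsCompressibility (ρ * σ ^ 3) - 1) - π_c ρ = c) →
    ∀ ρ ∈ Set.Ioo 0 b,
      π_c ρ = ρ * (Literature.MathematicalPhysics.KineticTheory.hsCompressibility (ρ * σ ^ 3) - 1)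

end Summit.AtomisticToContinuum.HydrodynamicLimit.Cruxes.CollisionalTransferLocality.Sketch
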